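import Summits.BirchSwinnertonDyer.BirchSwinnertonDyer.Theorems.PrintCf2RamifiedOffTYZGenusPeriodSecondNorm
import HarnessLib

/-!
# THE `(1+i)`-DESCENT ON `A : Y² = X³ + 4X` AND THE `(1+i)`-ADIC LADDER OF THE GENUS PERIOD: THEOREM A ⟺ `Z(n) ∈ (1+i)A(ℍ′_n)`,
# and the SECOND NORM CLASS IS THE FIRST COORDINATE OF THE `(1+i)`-HALF (crux stmt-BirchSwinnertonDyer-20509 `RamifiedOffTYZOfFacts`,
# line `offtyz-v7`, LEAD g31, lineage cycle 32)

HONEST FRAMING (cell `bsd-print-cf2`, route `PrintCf2`; `--supports stmt-BirchSwinnertonDyer-20509`; theorems only, `def`-free, no `sorry`).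
BSD is not proved by any of this; no class is closed by this file; item 23431 (C⁺) and crux 20509 stay OPEN.

WHERE THE LINE STANDS (g29/g30).  On the visible R2 rows (`n = lq`, `l ≡ 1`, `q ≡ 7 (mod 8)`, `ord_{s=1} L(E_n,s) = 1`, visible generator) the
conclusion of C⁺ at `n` is, in the kernel, «`Z(n) ∉ 2A(ℍ′_n) + tors`», and the complete `2`-descent class of the genus period is the norm pair
`κ_{ℍ′}(Z(n)) = ([N₁], [N₀])`, `N₁ = N_{H/L} x(z_n)`, `N₀ = N_{H(i)/M}(x(z_n) − 2i)`; THEOREM A (print-grade on paper) is `[N₁] = 1`, and granted it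
C⁺ ⟺ `N₀ ∉ ⟨i⟩·ℍ′²` (`GenusPeriodSecondNorm.levelTwo_iff_secondNorm_of_visible_R2_of_facts`, p802722).

THIS FILE reads both statements through the endomorphism `1 + i` of `A` (`[i](X, Y) = (−X, iY)` is the tree's additive automorphism `cmI`;
`(1+i)W := W + [i]W`; `(1+i)² = 2i`, so `(1+i)²A(F) = 2A(F)` over any field `F ∋ i`):

* §1 (pure algebra on `A` over a field `K` of characteristic `0` with `im² = −1`, fact-free):
  - `onePlusI_eq` — for `W = (u, v)` with `u ≠ 0`: **`W + [i]W = (L², −(L(L² − u) + v))` with `L = (1 − i)v/(2u)`** (chord through `(u, v)` and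
    `(−u, iv)`); so `X((1+i)W) = ((1−i)v/(2u))²` is a SQUARE, and (`A_onePlusI_X_sub_twoIm`, `…_add_twoIm`)
    **`X((1+i)W) − 2i = u·((1−i)(u+2)/(2u))²`, `X((1+i)W) + 2i = u·((1−i)(u−2)/(2u))²`** (`v² + 4u² = u(u+2)²`, `v² − 4u² = u(u−2)²`).
  - `twoDescentComponent_zero_onePlusI` — `κ⁰((1+i)W) = 1` for every `W ∈ A(K)`; `twoDescentComponent_twoIm_onePlusI` — `κ⁺((1+i)W) = [u] = κ⁰(W)`
    (`u ≠ 0, −2`): **the `T⁺`-coordinate of a `(1+i)`-multiple is the `τ(1)`-coordinate of its `(1+i)`-half.**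
  - `exists_onePlusI_eq_of_sq` — EXPLICIT `(1+i)`-HALVING: if `P = (X, Y) ∈ A(K)` and `X = s²`, `s ≠ 0`, then `W = (i(s³+Y)/s, i(1+i)(s³+Y))`
    satisfies `W + [i]W = P` (the chord slope is exactly `s`).
  - ★★ `twoDescentComponent_zero_eq_one_iff` — **`κ⁰(P) = 1 ⟺ P ∈ (1+i)A(K)`**: exactness of the `(1+i)`-descent sequence
    `A(K) —(1+i)→ A(K) —κ⁰→ K^×/K^{×2}` at `A(K)` (Silverman X.4.9 for the isogeny `1+i`, kernel `⟨τ(1)⟩`), proved by the explicit halving.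
* §2 (by name, on the line's objects):
  - ★★ `firstNorm_sq_iff_onePlusI_divisible` — granted the exact-descent identity `κ⁰(Z(d)) = [N₁]` (`N₁ ≠ 0`):
    **THEOREM A's conclusion «`N₁` is a square in `ℍ′_n`» ⟺ `Z(d) ∈ (1+i)A(ℍ′_n)`** (exactly — no torsion proviso).
  - ★★ `sqClass_secondNorm_eq_sqClass_X_half` — granted `κ⁺(Z(d)) = [N₀]` and a `(1+i)`-half `W = (u, v)` of a non-torsion `Z(d)`:
    **`[N₀] = [u]`** — the second norm class IS the first `2`-descent coordinate `[X(W)]` of the half.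
  - ★★★ `levelTwo_iff_half_X_not_sq_of_visible_R2_of_facts` — 𝔅_ram conjuncts 1, 2, 4, 5 + `tyz_sevenBlockCMData` ⟹ on every visible R2 row with
    `ord L = 1`, in the display package: `Z(n)` is non-torsion, `[i] ≠ 1`, and **granted THEOREM A (`[N₁] = 1`): C⁺ at `n` ⟺ for EVERY `W = (u, v) ∈ A(ℍ′_n)`
    with `W + [i]W = Z(n)`, neither `u` nor `u·i` is a square in `ℍ′_n`** — i.e. C⁺ on the visible R2 rows is precisely «THEOREM A FAILS, EVEN UP TO THE
    UNIT `i`, FOR THE `(1+i)`-HALF OF THE GENUS PERIOD»: the SAME square-class question one rung down the `(1+i)`-adic filtration of the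
    `ℤ[i]`-lattice `A(ℍ′_n)/tors` (THEOREM A: `(1+i)`-adic valuation of `Z(n)` is `≥ 1`; C⁺: it is exactly `1`).

WHY THIS MATTERS (memo `Cruxes/RamifiedOffTYZOfFacts/Lines/offtyz_v7_OnePlusILadder.md`): rung 0 (`κ⁰`, the cover `[1+i] : A → A` ≅ the Shimura cover
`X_{Γ'} → X₀(32)`, `Γ' = ker(2/·)`) is the UNIQUE cusp-unramified congruence cover of `X₀(32)` (the quotient `Γ₀(32)/⟨Γ(32), parabolics⟩` is `ℤ/2`:
the `d`-entries `{1, 9, 17, 25}` of the parabolic generators have index `2` in `(ℤ/32)^×/±1 ≅ ℤ/8`), so rung 1 (`κ⁰` of the half = `κ⁺` of `Z(n)`)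
is the value class of a NON-congruence modular function at EVERY level — no reciprocity law evaluates it.  This is the precise sense in which
`stub_offTYZ_secondNormNonsquare_visR2` is conjecture-grade while `stub_offTYZ_firstNormSquare_R2` is print-grade.

References: [cite: SilvermanAEC2009, III.2.3 (group law), Prop. X.1.4, Prop. X.4.9 (descent via isogeny)]; [cite: TianYuanZhang2017, §3.1 (p0010 L11),
§3.2 (p0011 L121–L128), Lemma 3.16 (p0017 L98–L113), Lemma 3.18, Thm. 3.5, Thm. 1.2]; [cite: BurungaleFlach2024, Thm 1.1 / Cor. 3];
[cite: Darmon2004, Thm. 3.22]; tree: p802722 (`…GenusPeriodSecondNorm`), p800643 (`…CurveATwoDivisionAlgebra`), p799839 (`…GenusPeriodExactDescent`).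
-/

noncomputable section

open scoped Classical

open WeierstrassCurve WeierstrassCurve.Affine WeierstrassCurve.Affine.Point
  Literature.NumberTheory.EllipticCurves Literature.NumberTheory.EllipticCurves.Rank1Residual
  Summit.BirchSwinnertonDyer.Rank1Residual
  Literature.NumberTheory.EllipticCurves.TianYuanZhang2017
  Literature.NumberTheory.EllipticCurves.TianYuanZhang2017.W2
  Summit.BirchSwinnertonDyer.PrintCf2.GenusPeriodTraceNorm

set_option autoImplicit false

namespace Summit.BirchSwinnertonDyer.PrintCf2.OnePlusIDescent

/-! ## §1 The endomorphism `1 + i` on `A : Y² = X³ + 4X` in coordinates, and the `(1+i)`-descent -/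

section Algebra

variable {K : Type} [Field K] [CharZero K]

/-- `im ≠ 0`, `im ≠ 1`, `1 − im ≠ 0` for a square root `im` of `−1` in characteristic `0`. [folklore] -/
theorem im_aux {im : K} (him : im ^ 2 = -1) : im ≠ 0 ∧ (1 - im) ≠ 0 ∧ (1 + im) ≠ 0 := by
  refine ⟨fun h => ?_, fun h => ?_, fun h => ?_⟩
  · rw [h] at him; norm_num at him
  · have : im = 1 := by linear_combination -h
    rw [this] at him; norm_num at him
  · have : im = -1 := by linear_combination h
    rw [this] at him; norm_num at him

/-- **`(1+i)` in coordinates.**  For `W = (u, v) ∈ A(K)` with `u ≠ 0`, the chord through `W` and `[i]W = (−u, iv)` has slope `L = (1 − i)v/(2u)`, and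
`W + [i]W = (L², −(L(L² − u) + v))`. [cite: SilvermanAEC2009, III.2.3] [cite: TianYuanZhang2017, §3.2 (p0011 L121–L128)] -/
theorem onePlusI_eq {im u v : K} (him : im ^ 2 = -1) (h : (curveA.baseChange K).toAffine.Nonsingular u v) (hu : u ≠ 0) :
    ∃ h' : (curveA.baseChange K).toAffine.Nonsingular (((1 - im) * v / (2 * u)) ^ 2)
        (-(((1 - im) * v / (2 * u)) * ((((1 - im) * v / (2 * u)) ^ 2) - u) + v)),
      (Point.some u v h : APoint K) + cmI im him (Point.some u v h) =
        Point.some (((1 - im) * v / (2 * u)) ^ 2) (-(((1 - im) * v / (2 * u)) * ((((1 - im) * v / (2 * u)) ^ 2) - u) + v)) h' := by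
  have hne : u ≠ -u := fun e => hu (by linear_combination e / 2)
  have heq : v ^ 2 = u ^ 3 + 4 * u := (curveA_nonsingular_iff u v).mp h
  have hN : (curveA.baseChange K).toAffine.Nonsingular (-u) (im * v) :=
    (curveA_nonsingular_iff _ _).mpr (by linear_combination (-1 : K) * heq + v ^ 2 * him)
  rw [cmI_some im him h]
  have hadd : (Point.some u v h : APoint K) + Point.some (-u) (im * v) hN =
      Point.some ((curveA.baseChange K).toAffine.addX u (-u) ((curveA.baseChange K).toAffine.slope u (-u) v (im * v)))
        ((curveA.baseChange K).toAffine.addY u (-u) v ((curveA.baseChange K).toAffine.slope u (-u) v (im * v)))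
        (nonsingular_add h hN fun hxy => hne hxy.left) := add_of_X_ne hne
  have hs : (curveA.baseChange K).toAffine.slope u (-u) v (im * v) = (1 - im) * v / (2 * u) := by
    rw [slope_of_X_ne hne]; field_simp; ring
  have hx' : (curveA.baseChange K).toAffine.addX u (-u) ((curveA.baseChange K).toAffine.slope u (-u) v (im * v)) =
      ((1 - im) * v / (2 * u)) ^ 2 := by
    rw [hs]; simp only [WeierstrassCurve.Affine.addX, A_a₁, A_a₂]; ring
  have hy' : (curveA.baseChange K).toAffine.addY u (-u) v ((curveA.baseChange K).toAffine.slope u (-u) v (im * v)) =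
      -(((1 - im) * v / (2 * u)) * ((((1 - im) * v / (2 * u)) ^ 2) - u) + v) := by
    rw [hs]; simp only [WeierstrassCurve.Affine.addY, WeierstrassCurve.Affine.negAddY, WeierstrassCurve.Affine.addX,
      WeierstrassCurve.Affine.negY, A_a₁, A_a₂, A_a₃]; ring
  obtain ⟨h', e⟩ := exists_some_eq _ hx' hy'
  exact ⟨h', hadd.trans e⟩

/-- **`X((1+i)W) − 2i = u·((1−i)(u+2)/(2u))²`** for `W = (u, v)`, `u ≠ 0` (uses `v² + 4u² = u(u+2)²`). [cite: SilvermanAEC2009, III.2.3, Prop. X.1.4 (proof)] -/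
theorem A_onePlusI_X_sub_twoIm {im u v : K} (him : im ^ 2 = -1) (hu : u ≠ 0) (heq : v ^ 2 = u ^ 3 + 4 * u) :
    ((1 - im) * v / (2 * u)) ^ 2 - 2 * im = u * ((1 - im) * (u + 2) / (2 * u)) ^ 2 := by
  field_simp
  linear_combination (-2 * im) * heq + (v ^ 2 - u * (u + 2) ^ 2) * him

/-- **`X((1+i)W) + 2i = u·((1−i)(u−2)/(2u))²`** for `W = (u, v)`, `u ≠ 0` (uses `v² − 4u² = u(u−2)²`). [cite: SilvermanAEC2009, III.2.3, Prop. X.1.4 (proof)] -/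
theorem A_onePlusI_X_add_twoIm {im u v : K} (him : im ^ 2 = -1) (hu : u ≠ 0) (heq : v ^ 2 = u ^ 3 + 4 * u) :
    ((1 - im) * v / (2 * u)) ^ 2 + 2 * im = u * ((1 - im) * (u - 2) / (2 * u)) ^ 2 := by
  field_simp
  linear_combination (-2 * im) * heq + (v ^ 2 - u * (u - 2) ^ 2) * him

/-- **`κ⁰((1+i)W) = 1`**: the `2`-descent component at `τ(1) = (0,0)` of any `(1+i)`-multiple is trivial (`X((1+i)W)` is a square; the degenerate values
`(1+i)O = O`, `(1+i)τ(1) = O` are covered). [cite: SilvermanAEC2009, Prop. X.1.4, Prop. X.4.9] -/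
theorem twoDescentComponent_zero_onePlusI {im : K} (him : im ^ 2 = -1) (W : APoint K) :
    twoDescentComponent (curveA.baseChange K).toAffine 0 (2 * im) (-(2 * im)) (W + cmI im him W) = 1 := by
  rcases W with _ | ⟨u, v, h⟩
  · rw [← zero_def, _root_.map_zero, add_zero, twoDescentComponent_zero]
  · by_cases hu : u = 0
    · have heq : v ^ 2 = u ^ 3 + 4 * u := (curveA_nonsingular_iff u v).mp h
      have hv : v = 0 := by
        subst hu
        have : v ^ 2 = 0 := by rw [heq]; ring
        exact pow_eq_zero_iff two_ne_zero |>.mp this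
      subst hu hv
      have e1 : (Point.some 0 0 h : APoint K) = tauOne := rfl
      rw [e1, cmI_tauOne, ← two_nsmul]
      have e2 : (2 : ℕ) • (tauOne : APoint K) = 0 := (TianYuanZhang2017.two_nsmul_some_eq_zero_iff _).mpr rfl
      rw [e2, twoDescentComponent_zero]
    · obtain ⟨h', e⟩ := onePlusI_eq him h hu
      rw [e]
      by_cases hL : ((1 - im) * v / (2 * u)) ^ 2 = 0
      · rw [twoDescentComponent_some_of_eq _ hL]
        have e4 : ((0 : K) - 2 * im) * (0 - -(2 * im)) = 2 ^ 2 := by linear_combination (-4 : K) * him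
        rw [e4, sqClass_sq]
      · rw [twoDescentComponent_some_of_ne _ hL, sub_zero, sqClass_sq]

/-- **`κ⁺((1+i)W) = [X(W)]`**: for `W = (u, v)` with `u ≠ 0, −2`, the `2`-descent component at `T⁺ = (2i, 0)` of `(1+i)W` is the square class of `u`
(`X((1+i)W) − 2i = u·□`). [cite: SilvermanAEC2009, Prop. X.1.4] -/
theorem twoDescentComponent_twoIm_onePlusI {im u v : K} (him : im ^ 2 = -1) (h : (curveA.baseChange K).toAffine.Nonsingular u v)
    (hu : u ≠ 0) (hu2 : u ≠ -2) :
    twoDescentComponent (curveA.baseChange K).toAffine (2 * im) 0 (-(2 * im)) (Point.some u v h + cmI im him (Point.some u v h)) =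
      sqClass u := by
  obtain ⟨h', e⟩ := onePlusI_eq him h hu
  have heq : v ^ 2 = u ^ 3 + 4 * u := (curveA_nonsingular_iff u v).mp h
  obtain ⟨-, h1i, -⟩ := im_aux him
  have hc : (1 - im) * (u + 2) / (2 * u) ≠ 0 :=
    div_ne_zero (mul_ne_zero h1i fun e0 => hu2 (by linear_combination e0)) (mul_ne_zero two_ne_zero hu)
  have hX : ((1 - im) * v / (2 * u)) ^ 2 - 2 * im = u * ((1 - im) * (u + 2) / (2 * u)) ^ 2 := A_onePlusI_X_sub_twoIm him hu heq
  have hne : ((1 - im) * v / (2 * u)) ^ 2 ≠ 2 * im := by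
    intro e2
    rw [e2, sub_self] at hX
    exact mul_ne_zero hu (pow_ne_zero 2 hc) hX.symm
  rw [e, twoDescentComponent_some_of_ne _ hne, hX, sqClass_mul hu (pow_ne_zero 2 hc), sqClass_sq, SqUnits.mul_one]

/-- The same, read as **`κ⁺((1+i)W) = κ⁰(W)`**: the `T⁺`-coordinate of a `(1+i)`-multiple is the `τ(1)`-coordinate of its `(1+i)`-half.
[cite: SilvermanAEC2009, Prop. X.1.4] -/
theorem twoDescentComponent_twoIm_onePlusI_eq_zero_half {im u v : K} (him : im ^ 2 = -1)
    (h : (curveA.baseChange K).toAffine.Nonsingular u v) (hu : u ≠ 0) (hu2 : u ≠ -2) :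
    twoDescentComponent (curveA.baseChange K).toAffine (2 * im) 0 (-(2 * im)) (Point.some u v h + cmI im him (Point.some u v h)) =
      twoDescentComponent (curveA.baseChange K).toAffine 0 (2 * im) (-(2 * im)) (Point.some u v h) := by
  rw [twoDescentComponent_twoIm_onePlusI him h hu hu2, twoDescentComponent_some_of_ne h hu, sub_zero]

/-- **EXPLICIT `(1+i)`-HALVING.**  If `P = (X, Y) ∈ A(K)` and `X = s²` with `s ≠ 0`, then `W = (i(s³ + Y)/s, i(1 + i)(s³ + Y)) ∈ A(K)` and
`W + [i]W = P` (the chord through `W` and `[i]W` has slope exactly `s`). [cite: SilvermanAEC2009, III.2.3, Prop. X.4.9 (proof)] -/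
theorem exists_onePlusI_eq_of_sq {im X Y s : K} (him : im ^ 2 = -1) (hP : (curveA.baseChange K).toAffine.Nonsingular X Y)
    (hs : s ≠ 0) (hX : X = s ^ 2) :
    ∃ W : APoint K, W + cmI im him W = Point.some X Y hP := by
  have hcurve : Y ^ 2 = X ^ 3 + 4 * X := (curveA_nonsingular_iff X Y).mp hP
  obtain ⟨hi0, h1i, h1i'⟩ := im_aux him
  have ht0 : s ^ 3 + Y ≠ 0 := by
    intro h0
    have h4 : (4 : K) * s ^ 2 = 0 := by rw [hX] at hcurve; linear_combination (-1 : K) * hcurve + (Y - s ^ 3) * h0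
    rcases mul_eq_zero.mp h4 with h4 | h4
    · norm_num at h4
    · exact hs (pow_eq_zero_iff two_ne_zero |>.mp h4)
  have hu : im * (s ^ 3 + Y) / s ≠ 0 := div_ne_zero (mul_ne_zero hi0 ht0) hs
  have hW : (curveA.baseChange K).toAffine.Nonsingular (im * (s ^ 3 + Y) / s) (im * (s ^ 3 + Y) * (1 + im)) :=
    (curveA_nonsingular_iff _ _).mpr (by
      rw [hX] at hcurve
      field_simp
      linear_combination (im * s ^ 3 * Y + im * s ^ 6 + s ^ 6 - Y ^ 2) * him + hcurve)
  refine ⟨Point.some _ _ hW, ?_⟩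
  obtain ⟨h', e⟩ := onePlusI_eq him hW hu
  rw [e]
  have hL : (1 - im) * (im * (s ^ 3 + Y) * (1 + im)) / (2 * (im * (s ^ 3 + Y) / s)) = s := by
    field_simp
    linear_combination (-1 : K) * him
  have hx : ((1 - im) * (im * (s ^ 3 + Y) * (1 + im)) / (2 * (im * (s ^ 3 + Y) / s))) ^ 2 = X := by rw [hL, hX]
  have hy : -(((1 - im) * (im * (s ^ 3 + Y) * (1 + im)) / (2 * (im * (s ^ 3 + Y) / s))) *
      ((((1 - im) * (im * (s ^ 3 + Y) * (1 + im)) / (2 * (im * (s ^ 3 + Y) / s))) ^ 2) - im * (s ^ 3 + Y) / s) +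
        im * (s ^ 3 + Y) * (1 + im)) = Y := by
    rw [hL]
    field_simp
    linear_combination (-(s ^ 3 + Y)) * him
  obtain ⟨h'', e'⟩ := exists_some_eq h' hx hy
  rw [e']

/-- ★★ **EXACTNESS OF THE `(1+i)`-DESCENT AT `A(K)`: `κ⁰(P) = 1 ⟺ P ∈ (1+i)A(K)`.**  The `2`-descent component at `τ(1) = (0, 0)` — the Kummer map
of the endomorphism `1 + i` (kernel `⟨τ(1)⟩`) into `H¹(K, A[1+i]) = K^×/K^{×2}` — vanishes exactly on the `(1+i)`-multiples `W + [i]W`.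
[cite: SilvermanAEC2009, Prop. X.4.9, Thm. X.4.2] [cite: TianYuanZhang2017, Lemma 3.16 (p0017 L105–L113)] -/
theorem twoDescentComponent_zero_eq_one_iff {im : K} (him : im ^ 2 = -1) (P : APoint K) :
    twoDescentComponent (curveA.baseChange K).toAffine 0 (2 * im) (-(2 * im)) P = 1 ↔ ∃ W : APoint K, W + cmI im him W = P := by
  constructor
  · intro hk
    rcases P with _ | ⟨X, Y, hP⟩
    · exact ⟨0, by rw [_root_.map_zero, add_zero]; rfl⟩
    · by_cases hX0 : X = 0
      · have hcurve : Y ^ 2 = X ^ 3 + 4 * X := (curveA_nonsingular_iff X Y).mp hP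
        have hY : Y = 0 := by
          subst hX0
          have : Y ^ 2 = 0 := by rw [hcurve]; ring
          exact pow_eq_zero_iff two_ne_zero |>.mp this
        subst hX0 hY
        refine ⟨ptTwoI im him, ?_⟩
        rw [cmI_ptTwoI, ← tauOne_add_ptTwoI him, add_left_comm, ← two_nsmul, two_nsmul_ptTwoI, add_zero]
        rfl
      · rw [twoDescentComponent_some_of_ne hP hX0, sub_zero, sqClass_eq_one_iff hX0] at hk
        obtain ⟨s, hs⟩ := hk
        have hs0 : s ≠ 0 := by rintro rfl; exact hX0 (by rw [hs]; ring)
        exact exists_onePlusI_eq_of_sq him hP hs0 hs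
  · rintro ⟨W, rfl⟩
    exact twoDescentComponent_zero_onePlusI him W

/-- **A `(1+i)`-half of a point that is not `2`-torsion is an affine point `(u, v)` with `u ≠ 0, −2`** (`(1+i)O = (1+i)τ(1) = O`, `(1+i)(−2, ±4i) = T^±`).
[cite: SilvermanAEC2009, III.2.3] [cite: TianYuanZhang2017, Lemma 3.16] -/
theorem half_affine_of_not_two_torsion {im : K} (him : im ^ 2 = -1) {W P : APoint K} (hW : W + cmI im him W = P)
    (hP : (2 : ℕ) • P ≠ 0) :
    ∃ (u v : K) (h : (curveA.baseChange K).toAffine.Nonsingular u v), W = Point.some u v h ∧ u ≠ 0 ∧ u ≠ -2 := by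
  rcases W with _ | ⟨u, v, h⟩
  · exact absurd (by rw [← hW, ← zero_def, _root_.map_zero, add_zero, smul_zero]) hP
  · refine ⟨u, v, h, rfl, fun hu => hP ?_, fun hu => hP ?_⟩
    · have heq : v ^ 2 = u ^ 3 + 4 * u := (curveA_nonsingular_iff u v).mp h
      have hv : v = 0 := by
        subst hu
        have : v ^ 2 = 0 := by rw [heq]; ring
        exact pow_eq_zero_iff two_ne_zero |>.mp this
      subst hu hv
      have e1 : (Point.some 0 0 h : APoint K) = tauOne := rfl
      rw [← hW, e1, cmI_tauOne, ← two_nsmul]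
      have e2 : (2 : ℕ) • (tauOne : APoint K) = 0 := (TianYuanZhang2017.two_nsmul_some_eq_zero_iff _).mpr rfl
      rw [e2, smul_zero]
    · have hu0 : u ≠ 0 := by rw [hu]; norm_num
      obtain ⟨h', e⟩ := onePlusI_eq him h hu0
      have heq : v ^ 2 = u ^ 3 + 4 * u := (curveA_nonsingular_iff u v).mp h
      rw [← hW, e]
      apply (TianYuanZhang2017.two_nsmul_some_eq_zero_iff _).mpr
      -- at `u = −2` the abscissa is `2i`, hence the ordinate vanishes
      have hx : ((1 - im) * v / (2 * u)) ^ 2 = 2 * im := by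
        have := A_onePlusI_X_sub_twoIm him hu0 heq
        rw [hu] at this ⊢
        linear_combination this
      have h'' := (curveA_nonsingular_iff _ _).mp h'
      have : (-((1 - im) * v / (2 * u) * (((1 - im) * v / (2 * u)) ^ 2 - u) + v)) ^ 2 = 0 := by
        rw [hx] at h'' ⊢; rw [h'']; linear_combination (8 * im) * him
      exact pow_eq_zero_iff two_ne_zero |>.mp this

end Algebra

/-! ## §2 The genus period read through `1 + i`: THEOREM A and the second norm, by name -/

section ByName

variable {n : ℕ}

/-- A non-torsion point is not `2`-torsion. [folklore] -/
theorem two_nsmul_ne_zero_of_not_isOfFinAddOrder {G : Type*} [AddMonoid G] {x : G} (hx : ¬ IsOfFinAddOrder x) :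
    (2 : ℕ) • x ≠ 0 :=
  fun h2 => hx (isOfFinAddOrder_iff_nsmul_eq_zero.mpr ⟨2, two_pos, h2⟩)

/-- ★★ **THEOREM A's conclusion ⟺ `(1+i)`-DIVISIBILITY OF THE GENUS PERIOD.**  Granted the exact-descent identity `κ⁰_{ℍ′}(Z(d)) = [N₁]`
(`N₁ = N_{H/L} x(z)`, p800776) with `N₁ ≠ 0`: **`N₁` is a square in `ℍ′_n` ⟺ `Z(d) = W + [i]W` for some `W ∈ A(ℍ′_n)`** — exactly, with no
torsion proviso (the `(1+i)`-descent is exact at `A(ℍ′_n)`). [cite: SilvermanAEC2009, Prop. X.4.9] [cite: TianYuanZhang2017, §3.1 (p0011 L53–L66), Lemma 3.16] -/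
theorem firstNorm_sq_iff_onePlusI_divisible (D : GenusPointData n) {d : ℕ} {N₁ : D.H} (hN : N₁ ≠ 0)
    (hED0 : twoDescentComponent (curveA.baseChange D.H).toAffine 0 (2 * D.im) (-(2 * D.im)) (D.Z d) = sqClass N₁) :
    (∃ r : D.H, N₁ = r ^ 2) ↔ ∃ W : APoint D.H, W + cmI D.im D.im_sq W = D.Z d := by
  rw [← sqClass_eq_one_iff hN, ← hED0]
  exact twoDescentComponent_zero_eq_one_iff D.im_sq (D.Z d)

/-- ★★ **THE SECOND NORM CLASS IS THE FIRST COORDINATE OF THE `(1+i)`-HALF.**  Granted the exact-descent identity `κ⁺_{ℍ′}(Z(d)) = [N₀]`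
(`N₀ = N_{H(i)/M}(x(z) − 2i)`, p800776) and `Z(d)` non-torsion: every `W ∈ A(ℍ′_n)` with `W + [i]W = Z(d)` is an affine point `(u, v)` with `u ≠ 0`
and **`[N₀] = [u] = κ⁰_{ℍ′}(W)`**. [cite: SilvermanAEC2009, Prop. X.1.4, Prop. X.4.9] [cite: TianYuanZhang2017, §3.1 (p0011 L53–L66), Lemma 3.16] -/
theorem sqClass_secondNorm_eq_sqClass_X_half (D : GenusPointData n) {d : ℕ} {N₀ : D.H}
    (hEDp : twoDescentComponent (curveA.baseChange D.H).toAffine (2 * D.im) 0 (-(2 * D.im)) (D.Z d) = sqClass N₀)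
    (hZ : ¬ IsOfFinAddOrder (D.Z d)) {W : APoint D.H} (hW : W + cmI D.im D.im_sq W = D.Z d) :
    ∃ (u v : D.H) (h : (curveA.baseChange D.H).toAffine.Nonsingular u v), W = Point.some u v h ∧ u ≠ 0 ∧
      sqClass N₀ = sqClass u ∧
      twoDescentComponent (curveA.baseChange D.H).toAffine 0 (2 * D.im) (-(2 * D.im)) W = sqClass u := by
  obtain ⟨u, v, h, rfl, hu, hu2⟩ := half_affine_of_not_two_torsion D.im_sq hW (two_nsmul_ne_zero_of_not_isOfFinAddOrder hZ)
  refine ⟨u, v, h, rfl, hu, ?_, ?_⟩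
  · rw [← hEDp, ← hW, twoDescentComponent_twoIm_onePlusI D.im_sq h hu hu2]
  · rw [twoDescentComponent_some_of_ne h hu, sub_zero]

/-- **`[N₀] ∈ {1, [i]}` read on the half**: with `N₀ ≠ 0` and a `(1+i)`-half `W = (u, v)` as above, `N₀ ∈ ℍ′² ∪ i⁻¹ℍ′² ⟺ u ∈ ℍ′² ∪ i⁻¹ℍ′²`.
[cite: SilvermanAEC2009, Prop. X.1.4] -/
theorem secondNorm_sq_or_iff_half (D : GenusPointData n) {N₀ u : D.H} (hN : N₀ ≠ 0) (hu : u ≠ 0) (he : sqClass N₀ = sqClass u) :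
    ((∃ s : D.H, N₀ = s ^ 2) ∨ ∃ s : D.H, N₀ * D.im = s ^ 2) ↔ ((∃ s : D.H, u = s ^ 2) ∨ ∃ s : D.H, u * D.im = s ^ 2) := by
  have hi0 := P2.ThetaDescent.im_ne_zero D
  rw [← sqClass_eq_one_iff hN, ← sqClass_eq_one_iff hu, ← GenusPeriodKummer.sqClass_eq_iff_exists_sq hN hi0,
    ← GenusPeriodKummer.sqClass_eq_iff_exists_sq hu hi0, he]

/-- ★★★ **C⁺ ON THE VISIBLE R2 ROWS ⟺ «THEOREM A FAILS, EVEN UP TO `i`, FOR THE `(1+i)`-HALF OF THE GENUS PERIOD».**  Granted conjuncts 1, 2, 4, 5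
of 𝔅_ram and the seven-block display `tyz_sevenBlockCMData`; primes `l ≡ 1`, `q ≡ 7 (mod 8)`, `n = lq`, `ord_{s=1} L(E_n, s) = 1`; a VISIBLE
generator `h = (X, Y)` of `A_n(ℚ)` modulo torsion (`X ∉ 2ℚ^{×2}`).  Then in the display package `D` (`Printed`, CM-compositum layer, Thm 3.5 at the
blocks) the genus period `Z(n)` is NOT torsion, `[i] ≠ 1`, and: **if `Z(n) = W₀ + [i]W₀` for some `W₀ ∈ A(ℍ′_n)` (⟺ THEOREM A, by
`firstNorm_sq_iff_onePlusI_divisible`), then `2 ∥ L` for every `L` with `𝓛(n)² = L²` ⟺ for EVERY `W = (u, v) ∈ A(ℍ′_n)` with `W + [i]W = Z(n)`,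
neither `u` nor `u·i` is a square in `ℍ′_n`.**  (THEOREM A is «`X(Z(n))` is a square»; C⁺ is «`X` of the half is NOT a square, nor `i⁻¹` times one».)
[cite: TianYuanZhang2017, §1, §3.1, Thm. 3.5, Lemma 3.18, Thm. 1.2] [cite: BurungaleFlach2024, Thm 1.1 / Cor. 3] [cite: Darmon2004, Thm. 3.22]
[cite: SilvermanAEC2009, Prop. X.1.4, Prop. X.4.9] -/
theorem levelTwo_iff_half_X_not_sq_of_visible_R2_of_facts (hGZK : rank_eq_analyticRank_of_analyticRank_le_one)
    (hmod : WeierstrassCurve.hasEntireLFunction_rat) (hCM0 : bsdTriple_of_hasCM_of_L_one_ne_zero) (h12 : thm12_parity_of_scriptL')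
    (hT : tyz_sevenBlockCMData)
    {l q : ℕ} (hl : l.Prime) (hq : q.Prime) (hl8 : l % 8 = 1) (hq8 : q % 8 = 7) (hn : n = l * q)
    (hr : (congruentNumberCurve n).analyticRank = 1)
    {X Y : ℚ} (h : (Atwo n).toAffine.Nonsingular X Y) (hX : ¬ ∃ s : ℚ, X = 2 * s ^ 2)
    (hgen : ∀ P : (Atwo n).toAffine.Point, ∃ m : ℤ, IsOfFinAddOrder (P - m • (Point.some X Y h : (Atwo n).toAffine.Point))) :
    ∃ D : GenusPointData n, D.Printed ∧ D.CMPointCompositumPrinted ∧ D.Thm35AtBlocks ∧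
      ¬ IsOfFinAddOrder (D.Z n) ∧ sqClass D.im ≠ 1 ∧
      ((∃ W₀ : APoint D.H, W₀ + cmI D.im D.im_sq W₀ = D.Z n) →
        ((∀ L : ℤ, IsScriptL n L → (2 : ℤ) ∣ L ∧ ¬ (4 : ℤ) ∣ L) ↔
          ∀ (u v : D.H) (hW : (curveA.baseChange D.H).toAffine.Nonsingular u v),
            (Point.some u v hW : APoint D.H) + cmI D.im D.im_sq (Point.some u v hW) = D.Z n →
              ¬ ((∃ s : D.H, u = s ^ 2) ∨ ∃ s : D.H, u * D.im = s ^ 2))) := by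
  obtain ⟨D, hPr, hC, hBl, M, _, _, _, ι, x₀, y₀, h₀, Φ, N₁, N₀, -, -, -, -, hN1, hN0, hZ, hi8, hED0, hEDp, hiff⟩ :=
    GenusPeriodSecondNorm.levelTwo_iff_secondNorm_of_visible_R2_of_facts hGZK hmod hCM0 h12 hT hl hq hl8 hq8 hn hr h hX hgen
  refine ⟨D, hPr, hC, hBl, hZ, hi8, fun hA => ?_⟩
  have hA1 : sqClass N₁ = 1 := by
    rw [sqClass_eq_one_iff hN1]; exact (firstNorm_sq_iff_onePlusI_divisible D hN1 hED0).mpr hA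
  rw [hiff hA1]
  constructor
  · intro hN u v hW hWZ hsq
    obtain ⟨u', v', h', e, hu', he', -⟩ := sqClass_secondNorm_eq_sqClass_X_half D hEDp hZ hWZ
    obtain ⟨rfl, rfl⟩ : u = u' ∧ v = v' := by
      have := (Point.some.injEq u v hW u' v' h').mp e; exact this
    exact hN ((secondNorm_sq_or_iff_half D hN0 hu' he').mpr hsq)
  · intro hall hsq
    obtain ⟨W₀, hW₀⟩ := hA
    obtain ⟨u, v, hW, rfl, hu, he, -⟩ := sqClass_secondNorm_eq_sqClass_X_half D hEDp hZ hW₀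
    exact hall u v hW hW₀ ((secondNorm_sq_or_iff_half D hN0 hu he).mp hsq)

/-- The same with 𝔅_ram VERBATIM (conjuncts 1, 2, 4, 5 used) + the display door `tyz_sevenBlockCMData`.
[cite: TianYuanZhang2017, §3.1, Thm. 3.5, Lemma 3.18, Thm. 1.2] [cite: SilvermanAEC2009, Prop. X.4.9] -/
theorem levelTwo_iff_half_X_not_sq_of_visible_R2_of_bundle
    (hB : Literature.NumberTheory.EllipticCurves.rank_eq_analyticRank_of_analyticRank_le_one ∧ WeierstrassCurve.hasEntireLFunction_rat ∧ WeierstrassCurve.bsdRHS_eq_of_isIsogenous ∧ Literature.NumberTheory.EllipticCurves.bsdTriple_of_hasCM_of_L_one_ne_zero ∧ Literature.NumberTheory.EllipticCurves.TianYuanZhang2017.thm12_parity_of_scriptL' ∧ Literature.NumberTheory.EllipticCurves.Tian2014.thm13_rank_one_and_sha_odd ∧ Literature.NumberTheory.QuadraticFields.RedeiReichardt.redeiReichardt_fourTwoCard_classGroup ∧ Literature.NumberTheory.EllipticCurves.LiLiuTian2024.thm12_bsd_congruentNumberCurve ∧ Literature.NumberTheory.EllipticCurves.Monsky1990.cor515_rank_eq_one_and_card_selmerGroup_two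 ∧ Literature.NumberTheory.EllipticCurves.HeathBrown1994.monsky_card_selmerGroup_two_even ∧ Literature.NumberTheory.EllipticCurves.Tian2014.tian2014_system_sMinus_genus)
    (hT : tyz_sevenBlockCMData)
    {l q : ℕ} (hl : l.Prime) (hq : q.Prime) (hl8 : l % 8 = 1) (hq8 : q % 8 = 7) (hn : n = l * q)
    (hr : (congruentNumberCurve n).analyticRank = 1)
    {X Y : ℚ} (h : (Atwo n).toAffine.Nonsingular X Y) (hX : ¬ ∃ s : ℚ, X = 2 * s ^ 2)
    (hgen : ∀ P : (Atwo n).toAffine.Point, ∃ m : ℤ, IsOfFinAddOrder (P - m • (Point.some X Y h : (Atwo n).toAffine.Point))) :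
    ∃ D : GenusPointData n, D.Printed ∧ D.CMPointCompositumPrinted ∧ D.Thm35AtBlocks ∧
      ¬ IsOfFinAddOrder (D.Z n) ∧ sqClass D.im ≠ 1 ∧
      ((∃ W₀ : APoint D.H, W₀ + cmI D.im D.im_sq W₀ = D.Z n) →
        ((∀ L : ℤ, IsScriptL n L → (2 : ℤ) ∣ L ∧ ¬ (4 : ℤ) ∣ L) ↔
          ∀ (u v : D.H) (hW : (curveA.baseChange D.H).toAffine.Nonsingular u v),
            (Point.some u v hW : APoint D.H) + cmI D.im D.im_sq (Point.some u v hW) = D.Z n →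
              ¬ ((∃ s : D.H, u = s ^ 2) ∨ ∃ s : D.H, u * D.im = s ^ 2))) :=
  levelTwo_iff_half_X_not_sq_of_visible_R2_of_facts hB.1 hB.2.1 hB.2.2.2.1 hB.2.2.2.2.1 hT hl hq hl8 hq8 hn hr h hX hgen

end ByName

end Summit.BirchSwinnertonDyer.PrintCf2.OnePlusIDescent

end
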